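import Mathlib
import Literature.Computability.AlgebraicComplexity.NestFreeMatchingPoly
import HarnessLib

/-!
# Route FifoMatching — crux `NNLinearDegreeCofactorHard` (stmt-ValiantsHypothesis-23918), line `internal_cofactor`:
# stub S2b, unit (F″) plumbing — the push-forward of a uniform law on a set of bit strings

The (ii) measure of SPEC `Lines/internal_cofactor-S2b-SPEC.md` is the law of `fifo (inflateWord R L m y)` for
`y` uniform on the band set `BB ⊆ (Fin (2J) → Bool)` (S6/S7).  This file abstracts the three "measure"
paragraphs of the landed `…NNMonotoneHardMeasure.exists_thick_measure`: for a nonempty finite set `BB` of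
seeds and a map `f` sending `BB` into a family `𝓕` of matchings, the weighting
`μ M := #{y ∈ BB : f y = M} / #BB` has total mass `1` on `𝓕`, and the mass of any event `E` is
`#{y ∈ BB : f y ∈ E} / #BB`; so a COUNT `#{y ∈ BB : f y ∈ E}·D ≤ #BB` gives `D · μ(E) ≤ 1`, which is the
shape consumed by `denseInternalHard_of_excisedAvoidingSpread` / `exists_balanced_split_of_complexity_family`.

* `sum_pushforward_eq`, `pushforward_mass_one`, `pushforward_event`, `pushforward_event_lt_of_count`.

Honest framing: plumbing for one stub of an OPEN crux; nothing here bears on the crux, `NNDivisionHard`,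
`NNNotVP` or `VP ≠ VNP` (NOT proved).  No definitions, no named facts. [folklore]
-/

noncomputable section

-- Sub = Summit single-conjunct layout: the duplicated namespace component is mandated by the tree.
set_option linter.dupNamespace false

namespace Summit.ValiantsHypothesis.ValiantsHypothesis.Theorems.FifoMatching.NNLinearDegreeCofactorHard.InternalCofactor

open Finset
open scoped NNReal

variable {Y α : Type*} [DecidableEq α]

/-- The mass of a set `E` under the push-forward weighting is the normalised count of its preimage
inside the seed set. [folklore] -/
theorem sum_pushforward_eq (BB : Finset Y) (f : Y → α) (E : Finset α) :
    ∑ M ∈ E, (((BB.filter fun y => f y = M).card : ℝ≥0) / (BB.card : ℝ≥0)) =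
      ((BB.filter fun y => f y ∈ E).card : ℝ≥0) / (BB.card : ℝ≥0) := by
  rw [← sum_div, ← Nat.cast_sum, sum_card_fiberwise_eq_card_filter]

/-- **Total mass one**: if `f` maps the nonempty seed set `BB` into `𝓕`, the push-forward weighting
is a probability weighting of `𝓕`. [folklore] -/
theorem pushforward_mass_one {BB : Finset Y} (hBB : BB.Nonempty) (f : Y → α) {𝓕 : Finset α}
    (hf : ∀ y ∈ BB, f y ∈ 𝓕) :
    ∑ M ∈ 𝓕, (((BB.filter fun y => f y = M).card : ℝ≥0) / (BB.card : ℝ≥0)) = 1 := by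
  rw [sum_pushforward_eq, filter_true_of_mem hf, div_self]
  exact_mod_cast hBB.card_pos.ne'

/-- **Mass of an event** (a filter of `𝓕`): the normalised count of the seeds mapped into it. [folklore] -/
theorem pushforward_event (BB : Finset Y) (f : Y → α) (𝓕 : Finset α) (P : α → Prop)
    [DecidablePred P] :
    ∑ M ∈ 𝓕.filter P, (((BB.filter fun y => f y = M).card : ℝ≥0) / (BB.card : ℝ≥0)) =
      ((BB.filter fun y => f y ∈ 𝓕 ∧ P (f y)).card : ℝ≥0) / (BB.card : ℝ≥0) := by
  rw [sum_pushforward_eq]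
  have hset : (BB.filter fun y => f y ∈ 𝓕.filter P) = (BB.filter fun y => f y ∈ 𝓕 ∧ P (f y)) :=
    filter_congr fun y _ => by rw [mem_filter]
  rw [hset]

/-- **From a count to a mass bound.**  If `D · #{y ∈ BB : f y ∈ 𝓕, P (f y)} < #BB` then
`D · μ{M ∈ 𝓕 : P M} < 1` for the push-forward weighting `μ`. [folklore] -/
theorem pushforward_event_lt_of_count {BB : Finset Y} (hBB : BB.Nonempty) (f : Y → α)
    (𝓕 : Finset α) (P : α → Prop) [DecidablePred P] {D : ℕ}
    (hcount : D * (BB.filter fun y => f y ∈ 𝓕 ∧ P (f y)).card < BB.card) :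
    (D : ℝ≥0) * ∑ M ∈ 𝓕.filter P, (((BB.filter fun y => f y = M).card : ℝ≥0) / (BB.card : ℝ≥0)) < 1 := by
  rw [pushforward_event, mul_div_assoc', div_lt_one (by exact_mod_cast hBB.card_pos), ← Nat.cast_mul]
  exact_mod_cast hcount

/-- The same with `≤`: `D · #{…} ≤ #BB` gives `D · μ{…} ≤ 1`. [folklore] -/
theorem pushforward_event_le_of_count {BB : Finset Y} (hBB : BB.Nonempty) (f : Y → α)
    (𝓕 : Finset α) (P : α → Prop) [DecidablePred P] {D : ℕ}
    (hcount : D * (BB.filter fun y => f y ∈ 𝓕 ∧ P (f y)).card ≤ BB.card) :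
    (D : ℝ≥0) * ∑ M ∈ 𝓕.filter P, (((BB.filter fun y => f y = M).card : ℝ≥0) / (BB.card : ℝ≥0)) ≤ 1 := by
  rw [pushforward_event, mul_div_assoc', div_le_one (by exact_mod_cast hBB.card_pos), ← Nat.cast_mul]
  exact_mod_cast hcount

end Summit.ValiantsHypothesis.ValiantsHypothesis.Theorems.FifoMatching.NNLinearDegreeCofactorHard.InternalCofactor

end
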